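import Summits.QuantumFields.YangMills.Theorems.BalabanUVNodesN15PerCubeGreenTwoGridQuotientFits
import Summits.QuantumFields.YangMills.Theorems.BalabanUVNodesN15PerCubeGreenTwoGridSmearedFits
import Summits.QuantumFields.YangMills.Theorems.BalabanUVNodesN15PerCubeGreenTwoGridSiteFits
import Summits.QuantumFields.YangMills.Theorems.BalabanUVNodesN15PerCubeGreenTwoGridCutRows
import Summits.QuantumFields.YangMills.Theorems.BalabanUVNodesN15PerCubeGreenTwoGridPairingGeometry
import HarnessLib

/-!
# N15 = NE2, road (c) — PROGRAMME (PC), (PC-E-K) ENTRY 2 «`G′(U)∇*_U` of [B9] (3.42), TWO GRIDS»: ★★ THE SIX BUMP-SMEARED ∕ SHIFTED ∕ QUOTIENT SPECIES FITS OF n15-c∕430 ON THE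
# (PC) SITE CARRIERS FROM THE SHARP FITS OF ENTRIES 0∕1 AND THE PAIRWISE SECOND-DIFFERENCE FIT — the radius-2 bump's windows in the box, King's pairing dichotomy, aligned cuts
# (dag-n15-c g38, n15-c∕431c)

Cell `pub-ymgap`, seat `pub-ymgap-dag-n15-c` (generation g38; R134 (a), s1; HUMAN RULING D-0062).  `bears_on: R4∕N15 · K3⁸ SpineGivenEndpointR13SepCoPHV (stmt-QuantumFields-27366)`;
filed `--kind proof --supports stmt-QuantumFields-27366 --as helper` — COUNT-NEUTRAL.  ONE theorem ([folklore] bookkeeping: finite-sum algebra + the landed bump ∕ box ∕ pairing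
geometry on sites); 0 `def`, 0 `sorry`.  Imports BY NAME n15-c∕431b `…TwoGridQuotientFits` (step ∕ Leibniz ∕ entry identities), n15-c∕431a `…TwoGridSmearedFits` (smear, cross),
dag-n15-a∕337 `…TwoGridSiteFits` (`abs_scBump'_sub_scBump_kingPr_le`, `abs_fgrad∕bgrad_scBump'_sub_le`), n15-c∕338 `…TwoGridCutRows` (`scChi'_eq_scChi_kingPr`), n15-c∕347
`…TwoGridPairingGeometry` (`scShift(′)_symm_eq_sub`); through them n15-c∕261∕261′ (`scChi(′)_lift_eq_one_of_near_bbox`), dag-n15-w4 `…BumpLattice` (`abs_cenRep_lt_of_bcube_ne_zero`,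
`abs_fgrad∕bgrad_bcube_le`, `abs_bcube_le_one`), dag-n15-c `kingPr_add∕sub_unitVec`, n15-c FILE 66 `coverXi_shift`.  Nothing in the tree is modified; nothing restated.

WHY ∕ WHAT.  n15-c∕430 `uN_idef_scAdjGreen_tr` (the entry-2 two-grid η-defect for the NAMED Green's functions) displays six pointwise species fits across King's pairing `π`:
`hfitCt`, `hfitAt` (bump-SMEARED values of `c`, `a_j`), `hfAsh1`, `hfAsh2` (SHIFTED smeared values of `a⁺_μ` at `x − e_μ`, `a⁻_μ` at `x + e_μ`), `hfgAf`, `hfgAb` (QUOTIENTS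
`∇_μ(χ̃•a⁺_μ)(x − e_μ)`, `∇_μ(χ̃•a⁻_μ)(x)`).  ★★ `sc_adjointSmearedFits` PRODUCES all six, for ABSTRACT bond-matrix fields `S′_k`, `S_k` (the transformed bond variables in the cube
gauges at the two grids, instantiated by the pairing file), from: the SHARP value fits `hfitC`, `hfitA` of n15-c∕340's interface (letter `o_V`, global), the PAIRWISE second-difference
fit `hB` of n15-c∕369 (`sc_hB_of_pairwiseLetters`'s conclusion shape, letter `o_B`, where `χ_k(πx′) ≠ 0`), and the rows of `a_j`, `c` (`≤ r_V`) and of `∇_μa^±_μ` (`≤ r_D`) where the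
sharp cut is live (n15-c∕430's internal `hAloc(′)`, `hCloc′`, `hDAf∕b(′)` shapes) — with the explicit letters `o_C = o_χr_V + o_V`, `o_A = o_C + η(c_tr_V + r_D)`,
`o_g = o₂r_V + c_t(o_V + ηr_D) + o_χr_D + |ι|o_B` (`o_χ = π(d+1)∕(L^kw)`, `o₂ = w⁻¹(L^kw)⁻¹(32π⁴ + π²(d+1))`, `c_t = π∕w`, `w = L^m`; all `O(η)` but `|ι|o_B`).  Mechanism: the
radius-2 bump's WINDOWS (`χ̃_k(x) ≠ 0 ⟹ χ_k = 1` at `x, x ± e_μ`, both grids), the aligned cuts `χ′ = χ∘π`, King's dichotomy `π(x′ ± e′_μ) ∈ {πx′, πx′ ± e_μ}` (so a shifted sharp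
fit is an unshifted one plus at most ONE coarse step `= η·(∇a)`), the Leibniz rule of n15-c∕431b, and the entry identities `(∇_μa⁺_μ)(x−e_μ) = nη⁻¹(S_μ(x) − S_μ(x−e_μ))`,
`(∇_μa⁻_μ)(x) = −(…)ᵀ` that turn `hB` into the quotient fits.  NO new estimate.

HONEST FRAMING ∕ LIMITS.  Finite-sum algebra and lattice geometry on MODEL carriers; nothing of [B5]∕[B6]∕[B9] asserted ((3.51)–(3.53) p.400, (3.62)–(3.65) pp.402–403, Thm 3.14
pp.426–427 = SHAPES ∕ the difference template).  NE2⁺ NOT PRINTED, NOT proved; N15 of record untouched (DISCHARGED AS CONSUMED, p687738); K3⁸ OPEN; counts of record UNMOVED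
(typed 28∕28 · discharged 8∕27); one finite 𝕋⁴ at fixed ε per index — NOT infinite volume, NOT OS on ℝ⁴, NOT a mass gap, NOT Clay.  Restate-immune (no Theses import).
-/

set_option autoImplicit false

noncomputable section

open scoped BigOperators Matrix
open Finset

namespace Summit.QuantumFields.YangMills.BalabanUVNodes.N15.Gluing

open Real
open Literature.MathematicalPhysics.QuantumFieldTheory.Balaban1983to89
open Literature.MathematicalPhysics.QuantumFieldTheory.Balaban1983to89.B5Prop11Plancherel (Tor fine unitVec)
open Summit.QuantumFields.YangMills.BalabanUVNodes.N15.BackgroundLayer (tCoefA tCoefC fgrad fgrad_apply bgrad bgrad_apply fgradMat)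
open Summit.QuantumFields.YangMills.BalabanUVNodes.N15.VectorPiece (kingPr kingPr_add_unitVec kingPr_sub_unitVec)
open Summit.QuantumFields.YangMills.BalabanUVNodes.N15.MatrixSpecies (liftMap liftEquiv liftEquiv_apply liftEquiv_symm_apply)
open Summit.QuantumFields.YangMills.BalabanUVNodes.N15.CurvedSpecies (gaugePair)

variable {d : ℕ}

section Fits

variable {L : ℕ} [NeZero L] {mv kk r : ℕ} {hL : Odd L ∧ 1 < L} (ι : Type) [Fintype ι] [DecidableEq ι]

set_option maxHeartbeats 1600000 in
/-- ★★ **THE SIX BUMP-SMEARED ∕ SHIFTED ∕ QUOTIENT SPECIES FITS OF n15-c∕430 FROM THE SHARP FITS AND THE PAIRWISE SECOND-DIFFERENCE FIT** (see the module docstring): for abstract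
bond-matrix fields `S′_k` (fine), `S_k` (coarse), the rows where the sharp cuts are live, the sharp value fits `o_V` and the second-difference fit `o_B` across King's pairing ⟹
n15-c∕430's `hfitCt ∧ hfitAt ∧ hfAsh1 ∧ hfAsh2 ∧ hfgAf ∧ hfgAb` with `o_C = o_χr_V + o_V`, `o_A = o_C + (ηc_tr_V + 1·(ηr_D))`, `o_g = o₂r_V + c_t(o_V + ηr_D) + o_χr_D + |ι|o_B`.
[cite: Balaban1985BackgroundPropagators, Thm 3.14 pp.426–427 (two-grid difference: template), (3.51)–(3.53) p.400, (3.62)–(3.65) pp.402–403 (shapes); King1986, p.664 (pairing convention)] -/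
theorem sc_adjointSmearedFits (hM : ∀ ν, cvM d L mv kk hL ν = 2 * L * L ^ mv) (hw : 0 < L ^ mv) (hL7 : 7 ≤ L)
    (S' : (Fin (d + 1) → ZMod (2 * L)) → Fin (d + 1) → ScX' d L mv kk r hL → Matrix ι ι ℝ) (S : (Fin (d + 1) → ZMod (2 * L)) → Fin (d + 1) → ScX d L mv kk hL → Matrix ι ι ℝ)
    {rV rD oV oB : ℝ} (hrV : 0 ≤ rV) (hrD : 0 ≤ rD) (hoV : 0 ≤ oV) (hoB : 0 ≤ oB)
    (hAloc' : ∀ k j' x', scChi' d L mv kk r hL k x' ≠ 0 → ∀ i, ∑ j, |(tCoefA ((((L ^ r * L ^ kk : ℕ) : ℝ))⁻¹) (gaugePair (scShift' d L mv kk r hL) (S' k))) j' x' i j| ≤ rV) (hAloc : ∀ k j' x, scChi d L mv kk hL k x ≠ 0 → ∀ i, ∑ j, |(tCoefA ((((L ^ kk : ℕ) : ℝ))⁻¹) (gaugePair (scShift d L mv kk hL) (S k))) j' x i j| ≤ rV)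
    (hCloc' : ∀ k x', scChi' d L mv kk r hL k x' ≠ 0 → ∀ i, ∑ j, |(tCoefC ((((L ^ r * L ^ kk : ℕ) : ℝ))⁻¹) (gaugePair (scShift' d L mv kk r hL) (S' k))) x' i j| ≤ rV)
    (hDA' : ∀ k μ x', scChi' d L mv kk r hL k x' ≠ 0 → ∀ i, (∑ j, |fgradMat (((L ^ r * L ^ kk : ℕ) : ℝ)) ((scShift' d L mv kk r hL) μ) ((tCoefA ((((L ^ r * L ^ kk : ℕ) : ℝ))⁻¹) (gaugePair (scShift' d L mv kk r hL) (S' k))) (Sum.inl μ)) x' i j| ≤ rD) ∧ (∑ j, |fgradMat (((L ^ r * L ^ kk : ℕ) : ℝ)) ((scShift' d L mv kk r hL) μ) ((tCoefA ((((L ^ r * L ^ kk : ℕ) : ℝ))⁻¹) (gaugePair (scShift' d L mv kk r hL) (S' k))) (Sum.inr μ)) x' i j| ≤ rD))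
    (hDA : ∀ k μ x, scChi d L mv kk hL k x ≠ 0 → ∀ i, (∑ j, |fgradMat (((L ^ kk : ℕ) : ℝ)) ((scShift d L mv kk hL) μ) ((tCoefA ((((L ^ kk : ℕ) : ℝ))⁻¹) (gaugePair (scShift d L mv kk hL) (S k))) (Sum.inl μ)) x i j| ≤ rD) ∧ (∑ j, |fgradMat (((L ^ kk : ℕ) : ℝ)) ((scShift d L mv kk hL) μ) ((tCoefA ((((L ^ kk : ℕ) : ℝ))⁻¹) (gaugePair (scShift d L mv kk hL) (S k))) (Sum.inr μ)) x i j| ≤ rD))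
    (hfitC : ∀ k x' i, ∑ j, |(scChi' d L mv kk r hL k x' • (tCoefC ((((L ^ r * L ^ kk : ℕ) : ℝ))⁻¹) (gaugePair (scShift' d L mv kk r hL) (S' k))) x' - scChi d L mv kk hL k ((kingPr L kk r (cvM d L mv kk hL)) x') • (tCoefC ((((L ^ kk : ℕ) : ℝ))⁻¹) (gaugePair (scShift d L mv kk hL) (S k))) ((kingPr L kk r (cvM d L mv kk hL)) x')) i j| ≤ oV)
    (hfitA : ∀ k j' x' i, ∑ j, |(scChi' d L mv kk r hL k x' • (tCoefA ((((L ^ r * L ^ kk : ℕ) : ℝ))⁻¹) (gaugePair (scShift' d L mv kk r hL) (S' k))) j' x' - scChi d L mv kk hL k ((kingPr L kk r (cvM d L mv kk hL)) x') • (tCoefA ((((L ^ kk : ℕ) : ℝ))⁻¹) (gaugePair (scShift d L mv kk hL) (S k))) j' ((kingPr L kk r (cvM d L mv kk hL)) x')) i j| ≤ oV)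
    (hB : ∀ k μ x', scChi d L mv kk hL k ((kingPr L kk r (cvM d L mv kk hL)) x') ≠ 0 → ∀ i j, |(((((((L ^ r * L ^ kk : ℕ) : ℝ))⁻¹))⁻¹ * (((((L ^ r * L ^ kk : ℕ) : ℝ))⁻¹))⁻¹) • (S' k μ x' - S' k μ (((scShift' d L mv kk r hL) μ).symm x')) - ((((((L ^ kk : ℕ) : ℝ))⁻¹))⁻¹ * (((((L ^ kk : ℕ) : ℝ))⁻¹))⁻¹) • (S k μ ((kingPr L kk r (cvM d L mv kk hL)) x') - S k μ (((scShift d L mv kk hL) μ).symm ((kingPr L kk r (cvM d L mv kk hL)) x')))) i j| ≤ oB) :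
    (∀ k x' i, ∑ j, |(scBump' d L mv kk r hL k x' • (tCoefC ((((L ^ r * L ^ kk : ℕ) : ℝ))⁻¹) (gaugePair (scShift' d L mv kk r hL) (S' k))) x') i j - (scBump d L mv kk hL k ((kingPr L kk r (cvM d L mv kk hL)) x') • (tCoefC ((((L ^ kk : ℕ) : ℝ))⁻¹) (gaugePair (scShift d L mv kk hL) (S k))) ((kingPr L kk r (cvM d L mv kk hL)) x')) i j| ≤ ((π * (d + 1) / ((((L ^ kk : ℕ) : ℝ)) * ((L ^ mv : ℕ) : ℝ))) * rV + oV)) ∧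
    (∀ k j' x' i, ∑ j, |(scBump' d L mv kk r hL k x' • (tCoefA ((((L ^ r * L ^ kk : ℕ) : ℝ))⁻¹) (gaugePair (scShift' d L mv kk r hL) (S' k))) j' x') i j - (scBump d L mv kk hL k ((kingPr L kk r (cvM d L mv kk hL)) x') • (tCoefA ((((L ^ kk : ℕ) : ℝ))⁻¹) (gaugePair (scShift d L mv kk hL) (S k))) j' ((kingPr L kk r (cvM d L mv kk hL)) x')) i j| ≤ ((π * (d + 1) / ((((L ^ kk : ℕ) : ℝ)) * ((L ^ mv : ℕ) : ℝ))) * rV + oV)) ∧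
    (∀ k μ x' i, ∑ j, |(scBump' d L mv kk r hL k (((scShift' d L mv kk r hL) μ).symm x') • (tCoefA ((((L ^ r * L ^ kk : ℕ) : ℝ))⁻¹) (gaugePair (scShift' d L mv kk r hL) (S' k))) (Sum.inl μ) (((scShift' d L mv kk r hL) μ).symm x')) i j - (scBump d L mv kk hL k (((scShift d L mv kk hL) μ).symm ((kingPr L kk r (cvM d L mv kk hL)) x')) • (tCoefA ((((L ^ kk : ℕ) : ℝ))⁻¹) (gaugePair (scShift d L mv kk hL) (S k))) (Sum.inl μ) (((scShift d L mv kk hL) μ).symm ((kingPr L kk r (cvM d L mv kk hL)) x'))) i j| ≤ ((π * (d + 1) / ((((L ^ kk : ℕ) : ℝ)) * ((L ^ mv : ℕ) : ℝ))) * rV + oV + (((((L ^ kk : ℕ) : ℝ))⁻¹) * (π / ((L ^ mv : ℕ) : ℝ)) * rV + 1 * (((((L ^ kk : ℕ) : ℝ))⁻¹) * rD)))) ∧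
    (∀ k μ x' i, ∑ j, |(scBump' d L mv kk r hL k ((scShift' d L mv kk r hL) μ x') • (tCoefA ((((L ^ r * L ^ kk : ℕ) : ℝ))⁻¹) (gaugePair (scShift' d L mv kk r hL) (S' k))) (Sum.inr μ) ((scShift' d L mv kk r hL) μ x')) i j - (scBump d L mv kk hL k ((scShift d L mv kk hL) μ ((kingPr L kk r (cvM d L mv kk hL)) x')) • (tCoefA ((((L ^ kk : ℕ) : ℝ))⁻¹) (gaugePair (scShift d L mv kk hL) (S k))) (Sum.inr μ) ((scShift d L mv kk hL) μ ((kingPr L kk r (cvM d L mv kk hL)) x'))) i j| ≤ ((π * (d + 1) / ((((L ^ kk : ℕ) : ℝ)) * ((L ^ mv : ℕ) : ℝ))) * rV + oV + (((((L ^ kk : ℕ) : ℝ))⁻¹) * (π / ((L ^ mv : ℕ) : ℝ)) * rV + 1 * (((((L ^ kk : ℕ) : ℝ))⁻¹) * rD)))) ∧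
    (∀ k μ x' i, ∑ j, |fgradMat (((L ^ r * L ^ kk : ℕ) : ℝ)) ((scShift' d L mv kk r hL) μ) (fun x => (scBump' d L mv kk r hL k x • (tCoefA ((((L ^ r * L ^ kk : ℕ) : ℝ))⁻¹) (gaugePair (scShift' d L mv kk r hL) (S' k))) (Sum.inl μ) x)) (((scShift' d L mv kk r hL) μ).symm x') i j - fgradMat (((L ^ kk : ℕ) : ℝ)) ((scShift d L mv kk hL) μ) (fun x => (scBump d L mv kk hL k x • (tCoefA ((((L ^ kk : ℕ) : ℝ))⁻¹) (gaugePair (scShift d L mv kk hL) (S k))) (Sum.inl μ) x)) (((scShift d L mv kk hL) μ).symm ((kingPr L kk r (cvM d L mv kk hL)) x')) i j| ≤ (((((L ^ mv : ℕ) : ℝ))⁻¹ * ((((L ^ kk : ℕ) : ℝ)) * ((L ^ mv : ℕ) : ℝ))⁻¹ * (32 * π ^ 4 + π ^ 2 * (d + 1))) * rV + (π / ((L ^ mv : ℕ) : ℝ)) * (oV + ((((L ^ kk : ℕ) : ℝ))⁻¹) * rD) + (π * (d + 1) / ((((L ^ kk : ℕ) : ℝ)) * ((L ^ mv : ℕ)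 : ℝ))) * rD + Fintype.card ι * oB)) ∧
    (∀ k μ x' i, ∑ j, |fgradMat (((L ^ r * L ^ kk : ℕ) : ℝ)) ((scShift' d L mv kk r hL) μ) (fun x => (scBump' d L mv kk r hL k x • (tCoefA ((((L ^ r * L ^ kk : ℕ) : ℝ))⁻¹) (gaugePair (scShift' d L mv kk r hL) (S' k))) (Sum.inr μ) x)) x' i j - fgradMat (((L ^ kk : ℕ) : ℝ)) ((scShift d L mv kk hL) μ) (fun x => (scBump d L mv kk hL k x • (tCoefA ((((L ^ kk : ℕ) : ℝ))⁻¹) (gaugePair (scShift d L mv kk hL) (S k))) (Sum.inr μ) x)) ((kingPr L kk r (cvM d L mv kk hL)) x') i j| ≤ (((((L ^ mv : ℕ) : ℝ))⁻¹ * ((((L ^ kk : ℕ) : ℝ)) * ((L ^ mv : ℕ) : ℝ))⁻¹ * (32 * π ^ 4 + π ^ 2 * (d + 1))) * rV + (π / ((L ^ mv : ℕ) : ℝ)) * (oV + ((((L ^ kk : ℕ) : ℝ))⁻¹) * rD) + (π * (d + 1) / ((((L ^ kk : ℕ) : ℝ)) * ((L ^ mv : ℕ) : ℝ))) * rD + Fintype.card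 ι * oB)) := by
  have hL4 : 4 ≤ L := (by omega); have hLpos : 0 < L := (by omega); have hK0 : 0 < 2 * L := (by omega)
  have hnr : (0 : ℝ) < (((L ^ kk : ℕ) : ℝ)) := Nat.cast_pos.mpr (pow_pos hLpos kk)
  have hnr' : (0 : ℝ) < (((L ^ r * L ^ kk : ℕ) : ℝ)) := Nat.cast_pos.mpr (Nat.mul_pos (pow_pos hLpos r) (pow_pos hLpos kk))
  have hη : (0 : ℝ) < ((((L ^ kk : ℕ) : ℝ))⁻¹) := inv_pos.mpr hnr
  have hWpos : (0 : ℝ) < ((L ^ mv : ℕ) : ℝ) := by exact_mod_cast hw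
  have hoχ0 : (0 : ℝ) ≤ (π * (d + 1) / ((((L ^ kk : ℕ) : ℝ)) * ((L ^ mv : ℕ) : ℝ))) := by positivity
  have ho₂0 : (0 : ℝ) ≤ ((((L ^ mv : ℕ) : ℝ))⁻¹ * ((((L ^ kk : ℕ) : ℝ)) * ((L ^ mv : ℕ) : ℝ))⁻¹ * (32 * π ^ 4 + π ^ 2 * (d + 1))) := by positivity
  have hct0 : (0 : ℝ) ≤ (π / ((L ^ mv : ℕ) : ℝ)) := by positivity
  -- the radius-2 bump's windows in the box `c(2w, k) + [0, 6w+1)`, both grids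
  have hlo : (2 : ℝ) * ((L ^ mv : ℕ) : ℝ) ≤ ((2 * L ^ mv : ℕ) : ℝ) := by push_cast; exact le_rfl
  have hhi : ((2 * L ^ mv : ℕ) : ℝ) + ((L ^ mv : ℕ) : ℝ) + (2 + 1) * ((L ^ mv : ℕ) : ℝ) + 1 ≤ ((6 * L ^ mv + 1 : ℕ) : ℝ) := by push_cast; linarith only []
  have hS6 : 6 * L ^ mv + 1 ≤ 2 * L * L ^ mv := by
    have h7 : 7 * L ^ mv ≤ L * L ^ mv := Nat.mul_le_mul_right _ hL7
    have e7 : 2 * L * L ^ mv = 2 * (L * L ^ mv) := by ring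
    rw [e7]; omega
  have hwinC : ∀ k x, scBump d L mv kk hL k x ≠ 0 → scChi d L mv kk hL k x = 1 ∧ ∀ μ, scChi d L mv kk hL k ((scShift d L mv kk hL) μ x) = 1 ∧ scChi d L mv kk hL k (((scShift d L mv kk hL) μ).symm x) = 1 := fun k x hx => by
    have hc : ∀ ν, |cenRep (2 * L) ((fun ν (p : ScX d L mv kk hL × Unit) => scXi d L mv kk hL ν p.1) ν (x, ()) - ((k ν).val : ℝ))| < 2 + 1 :=
      fun ν => abs_cenRep_lt_of_bcube_ne_zero (2 * L) (scXi d L mv kk hL) 2 hx ν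
    refine ⟨?_, fun μ => ⟨?_, ?_⟩⟩
    · exact scChi_lift_eq_one_of_near_bbox 2 Unit hM hw hlo hhi hS6 (0 : Fin (d + 1)) k (x, ()) ⟨(x, ()), Or.inl rfl, hc⟩
    · exact scChi_lift_eq_one_of_near_bbox 2 Unit hM hw hlo hhi hS6 μ k ((scShift d L mv kk hL) μ x, ()) ⟨(x, ()), Or.inr (Or.inr (by simp only [liftEquiv_symm_apply, Equiv.symm_apply_apply])), hc⟩
    · exact scChi_lift_eq_one_of_near_bbox 2 Unit hM hw hlo hhi hS6 μ k (((scShift d L mv kk hL) μ).symm x, ()) ⟨(x, ()), Or.inr (Or.inl (by simp only [liftEquiv_apply, Equiv.apply_symm_apply])), hc⟩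
  have hwinF : ∀ k x', scBump' d L mv kk r hL k x' ≠ 0 → scChi' d L mv kk r hL k x' = 1 ∧ ∀ μ, scChi' d L mv kk r hL k ((scShift' d L mv kk r hL) μ x') = 1 ∧ scChi' d L mv kk r hL k (((scShift' d L mv kk r hL) μ).symm x') = 1 := fun k x' hx => by
    have hc : ∀ ν, |cenRep (2 * L) ((fun ν (p : ScX' d L mv kk r hL × Unit) => scXi' d L mv kk r hL ν p.1) ν (x', ()) - ((k ν).val : ℝ))| < 2 + 1 :=
      fun ν => abs_cenRep_lt_of_bcube_ne_zero (2 * L) (scXi' d L mv kk r hL) 2 hx ν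
    refine ⟨?_, fun μ => ⟨?_, ?_⟩⟩
    · exact scChi'_lift_eq_one_of_near_bbox 2 Unit hM hw hlo hhi hS6 (0 : Fin (d + 1)) k (x', ()) ⟨(x', ()), Or.inl rfl, hc⟩
    · exact scChi'_lift_eq_one_of_near_bbox 2 Unit hM hw hlo hhi hS6 μ k ((scShift' d L mv kk r hL) μ x', ()) ⟨(x', ()), Or.inr (Or.inr (by simp only [liftEquiv_symm_apply, Equiv.symm_apply_apply])), hc⟩
    · exact scChi'_lift_eq_one_of_near_bbox 2 Unit hM hw hlo hhi hS6 μ k (((scShift' d L mv kk r hL) μ).symm x', ()) ⟨(x', ()), Or.inr (Or.inl (by simp only [liftEquiv_apply, Equiv.apply_symm_apply])), hc⟩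
  -- a live quotient weight puts both points in the box
  have hpairC : ∀ k μ x, (((L ^ kk : ℕ) : ℝ)) * (scBump d L mv kk hL k ((scShift d L mv kk hL) μ x) - scBump d L mv kk hL k x) ≠ 0 → scChi d L mv kk hL k x = 1 ∧ scChi d L mv kk hL k ((scShift d L mv kk hL) μ x) = 1 := fun k μ x h => by
    by_cases h0 : scBump d L mv kk hL k x = 0
    · have h1 : scBump d L mv kk hL k ((scShift d L mv kk hL) μ x) ≠ 0 := fun h1 => h (by rw [h0, h1, sub_self, mul_zero])
      exact ⟨by simpa only [Equiv.symm_apply_apply] using ((hwinC k _ h1).2 μ).2, (hwinC k _ h1).1⟩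
    · exact ⟨(hwinC k _ h0).1, ((hwinC k _ h0).2 μ).1⟩
  have hpairF : ∀ k μ x', (((L ^ r * L ^ kk : ℕ) : ℝ)) * (scBump' d L mv kk r hL k ((scShift' d L mv kk r hL) μ x') - scBump' d L mv kk r hL k x') ≠ 0 → scChi' d L mv kk r hL k x' = 1 ∧ scChi' d L mv kk r hL k ((scShift' d L mv kk r hL) μ x') = 1 := fun k μ x' h => by
    by_cases h0 : scBump' d L mv kk r hL k x' = 0
    · have h1 : scBump' d L mv kk r hL k ((scShift' d L mv kk r hL) μ x') ≠ 0 := fun h1 => h (by rw [h0, h1, sub_self, mul_zero])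
      exact ⟨by simpa only [Equiv.symm_apply_apply] using ((hwinF k _ h1).2 μ).2, (hwinF k _ h1).1⟩
    · exact ⟨(hwinF k _ h0).1, ((hwinF k _ h0).2 μ).1⟩
  -- aligned cuts; King's dichotomy one step forward ∕ back
  have hal : ∀ k x', scChi' d L mv kk r hL k x' = scChi d L mv kk hL k ((kingPr L kk r (cvM d L mv kk hL)) x') := fun k x' => scChi'_eq_scChi_kingPr k x'
  have hcrossF : ∀ μ (x' : ScX' d L mv kk r hL), (kingPr L kk r (cvM d L mv kk hL)) ((scShift' d L mv kk r hL) μ x') = (kingPr L kk r (cvM d L mv kk hL)) x' ∨ (kingPr L kk r (cvM d L mv kk hL)) ((scShift' d L mv kk r hL) μ x') = (scShift d L mv kk hL) μ ((kingPr L kk r (cvM d L mv kk hL)) x') := fun μ x' => by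
    have h := kingPr_add_unitVec (cvM d L mv kk hL) L kk r x' μ
    show (kingPr L kk r (cvM d L mv kk hL)) (x' + unitVec (fine (L ^ r * L ^ kk) (cvM d L mv kk hL)) μ) = (kingPr L kk r (cvM d L mv kk hL)) x' ∨ (kingPr L kk r (cvM d L mv kk hL)) (x' + unitVec (fine (L ^ r * L ^ kk) (cvM d L mv kk hL)) μ) = (kingPr L kk r (cvM d L mv kk hL)) x' + unitVec (fine (L ^ kk) (cvM d L mv kk hL)) μ
    rw [h]; split_ifs
    · exact Or.inr rfl
    · exact Or.inl rfl
  have hcrossB : ∀ μ (x' : ScX' d L mv kk r hL), (kingPr L kk r (cvM d L mv kk hL)) (((scShift' d L mv kk r hL) μ).symm x') = (kingPr L kk r (cvM d L mv kk hL)) x' ∨ (kingPr L kk r (cvM d L mv kk hL)) (((scShift' d L mv kk r hL) μ).symm x') = ((scShift d L mv kk hL) μ).symm ((kingPr L kk r (cvM d L mv kk hL)) x') := fun μ x' => by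
    rw [scShift'_symm_eq_sub, scShift_symm_eq_sub]; exact kingPr_sub_unitVec (cvM d L mv kk hL) L kk r x' μ
  -- fine cuts near a live coarse datum
  have hχ'F : ∀ k μ x', scChi d L mv kk hL k ((kingPr L kk r (cvM d L mv kk hL)) x') = 1 → scChi d L mv kk hL k ((scShift d L mv kk hL) μ ((kingPr L kk r (cvM d L mv kk hL)) x')) = 1 → scChi' d L mv kk r hL k ((scShift' d L mv kk r hL) μ x') ≠ 0 := fun k μ x' h1 h2 => by
    rw [hal]; rcases hcrossF μ x' with e | e
    · rw [e, h1]; exact one_ne_zero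
    · rw [e, h2]; exact one_ne_zero
  have hχ'B : ∀ k μ x', scChi d L mv kk hL k ((kingPr L kk r (cvM d L mv kk hL)) x') = 1 → scChi d L mv kk hL k (((scShift d L mv kk hL) μ).symm ((kingPr L kk r (cvM d L mv kk hL)) x')) = 1 → scChi' d L mv kk r hL k (((scShift' d L mv kk r hL) μ).symm x') ≠ 0 := fun k μ x' h1 h2 => by
    rw [hal]; rcases hcrossB μ x' with e | e
    · rw [e, h1]; exact one_ne_zero
    · rw [e, h2]; exact one_ne_zero
  -- the bump: size, two-grid value fit, quotient sizes, two-grid quotient fits (dag-n15-a∕337, dag-n15-w4)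
  have hb1 : ∀ k x, |scBump d L mv kk hL k x| ≤ 1 := fun k x => abs_bcube_le_one (2 * L) (scXi d L mv kk hL) 2 k x
  have hfitχ : ∀ k x', |scBump' d L mv kk r hL k x' - scBump d L mv kk hL k ((kingPr L kk r (cvM d L mv kk hL)) x')| ≤ (π * (d + 1) / ((((L ^ kk : ℕ) : ℝ)) * ((L ^ mv : ℕ) : ℝ))) := fun k x' => abs_scBump'_sub_scBump_kingPr_le hM hw k x'
  have hξ0 : ∀ μ ν (x : ScX d L mv kk hL), ∃ z : ℤ, scXi d L mv kk hL ν ((scShift d L mv kk hL) μ x) = scXi d L mv kk hL ν x + (if ν = μ then ((((L ^ kk : ℕ) : ℝ)) * ((L ^ mv : ℕ) : ℝ))⁻¹ else 0) + (z : ℝ) * ((2 * L : ℕ) : ℝ) :=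
    fun μ ν x => coverXi_shift (n := L ^ kk) (q := L) hM hw μ ν (x, 0)
  have hsW : |(((L ^ kk : ℕ) : ℝ))| * (π * |((((L ^ kk : ℕ) : ℝ)) * ((L ^ mv : ℕ) : ℝ))⁻¹|) = (π / ((L ^ mv : ℕ) : ℝ)) := by rw [abs_of_pos hnr, abs_of_nonneg (by positivity), mul_inv]; field_simp
  have hctF : ∀ k μ x, |(((L ^ kk : ℕ) : ℝ)) * (scBump d L mv kk hL k ((scShift d L mv kk hL) μ x) - scBump d L mv kk hL k x)| ≤ (π / ((L ^ mv : ℕ) : ℝ)) := fun k μ x => by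
    have h := abs_fgrad_bcube_le (2 * L) (scXi d L mv kk hL) 2 (scShift d L mv kk hL) hK0 hξ0 (((L ^ kk : ℕ) : ℝ)) k μ x
    rw [fgrad_apply] at h; exact h.trans hsW.le
  have hctB : ∀ k μ x, |(((L ^ kk : ℕ) : ℝ)) * (scBump d L mv kk hL k x - scBump d L mv kk hL k (((scShift d L mv kk hL) μ).symm x))| ≤ (π / ((L ^ mv : ℕ) : ℝ)) := fun k μ x => by
    have h := abs_bgrad_bcube_le (2 * L) (scXi d L mv kk hL) 2 (scShift d L mv kk hL) hK0 hξ0 (((L ^ kk : ℕ) : ℝ)) k μ x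
    rw [bgrad_apply] at h; exact h.trans hsW.le
  have hstF : ∀ k μ x, |scBump d L mv kk hL k ((scShift d L mv kk hL) μ x) - scBump d L mv kk hL k x| ≤ ((((L ^ kk : ℕ) : ℝ))⁻¹) * (π / ((L ^ mv : ℕ) : ℝ)) := fun k μ x =>
    calc |scBump d L mv kk hL k ((scShift d L mv kk hL) μ x) - scBump d L mv kk hL k x| = ((((L ^ kk : ℕ) : ℝ))⁻¹) * |(((L ^ kk : ℕ) : ℝ)) * (scBump d L mv kk hL k ((scShift d L mv kk hL) μ x) - scBump d L mv kk hL k x)| := by rw [abs_mul, abs_of_pos hnr, ← mul_assoc, inv_mul_cancel₀ hnr.ne', one_mul]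
      _ ≤ ((((L ^ kk : ℕ) : ℝ))⁻¹) * (π / ((L ^ mv : ℕ) : ℝ)) := mul_le_mul_of_nonneg_left (hctF k μ x) hη.le
  have hstB : ∀ k μ x, |scBump d L mv kk hL k (((scShift d L mv kk hL) μ).symm x) - scBump d L mv kk hL k x| ≤ ((((L ^ kk : ℕ) : ℝ))⁻¹) * (π / ((L ^ mv : ℕ) : ℝ)) := fun k μ x =>
    calc |scBump d L mv kk hL k (((scShift d L mv kk hL) μ).symm x) - scBump d L mv kk hL k x| = ((((L ^ kk : ℕ) : ℝ))⁻¹) * |(((L ^ kk : ℕ) : ℝ)) * (scBump d L mv kk hL k x - scBump d L mv kk hL k (((scShift d L mv kk hL) μ).symm x))| := by rw [abs_mul, abs_of_pos hnr, ← mul_assoc, inv_mul_cancel₀ hnr.ne', one_mul, abs_sub_comm]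
      _ ≤ ((((L ^ kk : ℕ) : ℝ))⁻¹) * (π / ((L ^ mv : ℕ) : ℝ)) := mul_le_mul_of_nonneg_left (hctB k μ x) hη.le
  have hfit₂ : ∀ k μ x', |(((L ^ r * L ^ kk : ℕ) : ℝ)) * (scBump' d L mv kk r hL k ((scShift' d L mv kk r hL) μ x') - scBump' d L mv kk r hL k x') - (((L ^ kk : ℕ) : ℝ)) * (scBump d L mv kk hL k ((scShift d L mv kk hL) μ ((kingPr L kk r (cvM d L mv kk hL)) x')) - scBump d L mv kk hL k ((kingPr L kk r (cvM d L mv kk hL)) x'))| ≤ ((((L ^ mv : ℕ) : ℝ))⁻¹ * ((((L ^ kk : ℕ) : ℝ)) * ((L ^ mv : ℕ) : ℝ))⁻¹ * (32 * π ^ 4 + π ^ 2 * (d + 1))) := fun k μ x' => by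
    have h := abs_fgrad_scBump'_sub_le Unit hM hw hL4 k μ (x', ())
    simpa only [fgrad_apply, liftEquiv_apply, liftMap] using h
  have hfit₂b : ∀ k μ x', |(((L ^ r * L ^ kk : ℕ) : ℝ)) * (scBump' d L mv kk r hL k x' - scBump' d L mv kk r hL k (((scShift' d L mv kk r hL) μ).symm x')) - (((L ^ kk : ℕ) : ℝ)) * (scBump d L mv kk hL k ((kingPr L kk r (cvM d L mv kk hL)) x') - scBump d L mv kk hL k (((scShift d L mv kk hL) μ).symm ((kingPr L kk r (cvM d L mv kk hL)) x')))| ≤ ((((L ^ mv : ℕ) : ℝ))⁻¹ * ((((L ^ kk : ℕ) : ℝ)) * ((L ^ mv : ℕ) : ℝ))⁻¹ * (32 * π ^ 4 + π ^ 2 * (d + 1))) := fun k μ x' => by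
    have h := abs_bgrad_scBump'_sub_le Unit hM hw hL4 k μ (x', ())
    simpa only [bgrad_apply, liftEquiv_symm_apply, liftMap] using h
  -- one coarse step of `a^±` is `η·(∇a)`
  have hstepAf : ∀ k μ x, scChi d L mv kk hL k (((scShift d L mv kk hL) μ).symm x) ≠ 0 → ∀ i, ∑ j, |((tCoefA ((((L ^ kk : ℕ) : ℝ))⁻¹) (gaugePair (scShift d L mv kk hL) (S k))) (Sum.inl μ) (((scShift d L mv kk hL) μ).symm x) - (tCoefA ((((L ^ kk : ℕ) : ℝ))⁻¹) (gaugePair (scShift d L mv kk hL) (S k))) (Sum.inl μ) x) i j| ≤ ((((L ^ kk : ℕ) : ℝ))⁻¹) * rD := fun k μ x hχ i => by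
    rw [rowSum_sub_comm]
    have h' := rowSum_sub_eq_inv_mul_rowSum_fgradMat hnr.ne' ((scShift d L mv kk hL) μ) ((tCoefA ((((L ^ kk : ℕ) : ℝ))⁻¹) (gaugePair (scShift d L mv kk hL) (S k))) (Sum.inl μ)) (((scShift d L mv kk hL) μ).symm x) i
    rw [Equiv.apply_symm_apply] at h'
    rw [h', abs_inv, abs_of_pos hnr]
    exact mul_le_mul_of_nonneg_left (hDA k μ _ hχ i).1 hη.le
  have hstepAb : ∀ k μ x, scChi d L mv kk hL k x ≠ 0 → ∀ i, ∑ j, |((tCoefA ((((L ^ kk : ℕ) : ℝ))⁻¹) (gaugePair (scShift d L mv kk hL) (S k))) (Sum.inr μ) ((scShift d L mv kk hL) μ x) - (tCoefA ((((L ^ kk : ℕ) : ℝ))⁻¹) (gaugePair (scShift d L mv kk hL) (S k))) (Sum.inr μ) x) i j| ≤ ((((L ^ kk : ℕ) : ℝ))⁻¹) * rD := fun k μ x hχ i => by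
    rw [rowSum_sub_eq_inv_mul_rowSum_fgradMat hnr.ne' ((scShift d L mv kk hL) μ) ((tCoefA ((((L ^ kk : ℕ) : ℝ))⁻¹) (gaugePair (scShift d L mv kk hL) (S k))) (Sum.inr μ)) x i, abs_inv, abs_of_pos hnr]
    exact mul_le_mul_of_nonneg_left (hDA k μ _ hχ i).2 hη.le
  -- (1)(2) the smeared value fits (n15-c∕431a §1)
  have hCt : ∀ k x' i, ∑ j, |(scBump' d L mv kk r hL k x' • (tCoefC ((((L ^ r * L ^ kk : ℕ) : ℝ))⁻¹) (gaugePair (scShift' d L mv kk r hL) (S' k))) x') i j - (scBump d L mv kk hL k ((kingPr L kk r (cvM d L mv kk hL)) x') • (tCoefC ((((L ^ kk : ℕ) : ℝ))⁻¹) (gaugePair (scShift d L mv kk hL) (S k))) ((kingPr L kk r (cvM d L mv kk hL)) x')) i j| ≤ ((π * (d + 1) / ((((L ^ kk : ℕ) : ℝ)) * ((L ^ mv : ℕ) : ℝ))) * rV + oV) := fun k x' i =>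
    rowSum_smul_sub_smul_le_of_sharp (kingPr L kk r (cvM d L mv kk hL)) (scBump' d L mv kk r hL k) (scChi' d L mv kk r hL k) (scBump d L mv kk hL k) (scChi d L mv kk hL k) (tCoefC ((((L ^ r * L ^ kk : ℕ) : ℝ))⁻¹) (gaugePair (scShift' d L mv kk r hL) (S' k))) (tCoefC ((((L ^ kk : ℕ) : ℝ))⁻¹) (gaugePair (scShift d L mv kk hL) (S k))) hoχ0 hrV hoV (hb1 k) (hfitχ k) (fun x' hx' => (hwinF k x' hx').1)
      (fun x' hx => ⟨by rw [hal, (hwinC k _ hx).1], (hwinC k _ hx).1⟩) (hCloc' k) (hfitC k) x' i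
  have hAt : ∀ k j' x' i, ∑ j, |(scBump' d L mv kk r hL k x' • (tCoefA ((((L ^ r * L ^ kk : ℕ) : ℝ))⁻¹) (gaugePair (scShift' d L mv kk r hL) (S' k))) j' x') i j - (scBump d L mv kk hL k ((kingPr L kk r (cvM d L mv kk hL)) x') • (tCoefA ((((L ^ kk : ℕ) : ℝ))⁻¹) (gaugePair (scShift d L mv kk hL) (S k))) j' ((kingPr L kk r (cvM d L mv kk hL)) x')) i j| ≤ ((π * (d + 1) / ((((L ^ kk : ℕ) : ℝ)) * ((L ^ mv : ℕ) : ℝ))) * rV + oV) := fun k j' x' i =>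
    rowSum_smul_sub_smul_le_of_sharp (kingPr L kk r (cvM d L mv kk hL)) (scBump' d L mv kk r hL k) (scChi' d L mv kk r hL k) (scBump d L mv kk hL k) (scChi d L mv kk hL k) ((tCoefA ((((L ^ r * L ^ kk : ℕ) : ℝ))⁻¹) (gaugePair (scShift' d L mv kk r hL) (S' k))) j') ((tCoefA ((((L ^ kk : ℕ) : ℝ))⁻¹) (gaugePair (scShift d L mv kk hL) (S k))) j') hoχ0 hrV hoV (hb1 k) (hfitχ k) (fun x' hx' => (hwinF k x' hx').1)
      (fun x' hx => ⟨by rw [hal, (hwinC k _ hx).1], (hwinC k _ hx).1⟩) (hAloc' k j') (hfitA k j') x' i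
  -- (3)(4) the shifted smeared fits (n15-c∕431a §2: cross + n15-c∕431b §1: step)
  have hAsh1 : ∀ k μ x' i, ∑ j, |(scBump' d L mv kk r hL k (((scShift' d L mv kk r hL) μ).symm x') • (tCoefA ((((L ^ r * L ^ kk : ℕ) : ℝ))⁻¹) (gaugePair (scShift' d L mv kk r hL) (S' k))) (Sum.inl μ) (((scShift' d L mv kk r hL) μ).symm x')) i j - (scBump d L mv kk hL k (((scShift d L mv kk hL) μ).symm ((kingPr L kk r (cvM d L mv kk hL)) x')) • (tCoefA ((((L ^ kk : ℕ) : ℝ))⁻¹) (gaugePair (scShift d L mv kk hL) (S k))) (Sum.inl μ) (((scShift d L mv kk hL) μ).symm ((kingPr L kk r (cvM d L mv kk hL)) x'))) i j| ≤ ((π * (d + 1) / ((((L ^ kk : ℕ) : ℝ)) * ((L ^ mv : ℕ) : ℝ))) * rV + oV + (((((L ^ kk : ℕ) : ℝ))⁻¹) * (π / ((L ^ mv : ℕ) : ℝ)) * rV + 1 * (((((L ^ kk : ℕ) : ℝ))⁻¹) * rD))) := fun k μ x' i => by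
    refine rowSum_shift_fit_of_cross (kingPr L kk r (cvM d L mv kk hL)) (⇑((scShift d L mv kk hL) μ).symm) (⇑((scShift' d L mv kk r hL) μ).symm) (fun x => scBump d L mv kk hL k x • (tCoefA ((((L ^ kk : ℕ) : ℝ))⁻¹) (gaugePair (scShift d L mv kk hL) (S k))) (Sum.inl μ) x) (fun x' => scBump' d L mv kk r hL k x' • (tCoefA ((((L ^ r * L ^ kk : ℕ) : ℝ))⁻¹) (gaugePair (scShift' d L mv kk r hL) (S' k))) (Sum.inl μ) x') (by positivity)
      (fun y' i => hAt k (Sum.inl μ) y' i) (fun z i => ?_) (hcrossB μ) x' i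
    refine rowSum_smul_step_le (scBump d L mv kk hL k z) (scBump d L mv kk hL k (((scShift d L mv kk hL) μ).symm z)) ((tCoefA ((((L ^ kk : ℕ) : ℝ))⁻¹) (gaugePair (scShift d L mv kk hL) (S k))) (Sum.inl μ) z) ((tCoefA ((((L ^ kk : ℕ) : ℝ))⁻¹) (gaugePair (scShift d L mv kk hL) (S k))) (Sum.inl μ) (((scShift d L mv kk hL) μ).symm z)) (by positivity) zero_le_one hrV (by positivity) (hstB k μ z) (hb1 k z) i
      (fun h => hAloc k (Sum.inl μ) _ ?_ i) (fun h => hstepAf k μ z (by rw [((hwinC k z h).2 μ).2]; exact one_ne_zero) i)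
    rcases h with h | h
    · rw [(hwinC k _ h).1]; exact one_ne_zero
    · rw [((hwinC k _ h).2 μ).2]; exact one_ne_zero
  have hAsh2 : ∀ k μ x' i, ∑ j, |(scBump' d L mv kk r hL k ((scShift' d L mv kk r hL) μ x') • (tCoefA ((((L ^ r * L ^ kk : ℕ) : ℝ))⁻¹) (gaugePair (scShift' d L mv kk r hL) (S' k))) (Sum.inr μ) ((scShift' d L mv kk r hL) μ x')) i j - (scBump d L mv kk hL k ((scShift d L mv kk hL) μ ((kingPr L kk r (cvM d L mv kk hL)) x')) • (tCoefA ((((L ^ kk : ℕ) : ℝ))⁻¹) (gaugePair (scShift d L mv kk hL) (S k))) (Sum.inr μ) ((scShift d L mv kk hL) μ ((kingPr L kk r (cvM d L mv kk hL)) x'))) i j| ≤ ((π * (d + 1) / ((((L ^ kk : ℕ) : ℝ)) * ((L ^ mv : ℕ) : ℝ))) * rV + oV + (((((L ^ kk : ℕ) : ℝ))⁻¹) * (π / ((L ^ mv : ℕ) : ℝ)) * rV + 1 * (((((L ^ kk : ℕ) : ℝ))⁻¹) * rD))) := fun k μ x' i => by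
    refine rowSum_shift_fit_of_cross (kingPr L kk r (cvM d L mv kk hL)) (⇑((scShift d L mv kk hL) μ)) (⇑((scShift' d L mv kk r hL) μ)) (fun x => scBump d L mv kk hL k x • (tCoefA ((((L ^ kk : ℕ) : ℝ))⁻¹) (gaugePair (scShift d L mv kk hL) (S k))) (Sum.inr μ) x) (fun x' => scBump' d L mv kk r hL k x' • (tCoefA ((((L ^ r * L ^ kk : ℕ) : ℝ))⁻¹) (gaugePair (scShift' d L mv kk r hL) (S' k))) (Sum.inr μ) x') (by positivity)
      (fun y' i => hAt k (Sum.inr μ) y' i) (fun z i => ?_) (hcrossF μ) x' i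
    refine rowSum_smul_step_le (scBump d L mv kk hL k z) (scBump d L mv kk hL k ((scShift d L mv kk hL) μ z)) ((tCoefA ((((L ^ kk : ℕ) : ℝ))⁻¹) (gaugePair (scShift d L mv kk hL) (S k))) (Sum.inr μ) z) ((tCoefA ((((L ^ kk : ℕ) : ℝ))⁻¹) (gaugePair (scShift d L mv kk hL) (S k))) (Sum.inr μ) ((scShift d L mv kk hL) μ z)) (by positivity) zero_le_one hrV (by positivity) (hstF k μ z) (hb1 k z) i
      (fun h => hAloc k (Sum.inr μ) _ ?_ i) (fun h => hstepAb k μ z (by rw [(hwinC k z h).1]; exact one_ne_zero) i)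
    rcases h with h | h
    · rw [(hwinC k _ h).1]; exact one_ne_zero
    · rw [((hwinC k _ h).2 μ).1]; exact one_ne_zero
  -- (5) the quotient fit of `χ̃•a⁺_μ` one step back (n15-c∕431b §2, shifted weight form; `hB` through `fgradMat_tCoefA_inl_symm_apply`)
  have hgAf : ∀ k μ x' i, ∑ j, |fgradMat (((L ^ r * L ^ kk : ℕ) : ℝ)) ((scShift' d L mv kk r hL) μ) (fun x => (scBump' d L mv kk r hL k x • (tCoefA ((((L ^ r * L ^ kk : ℕ) : ℝ))⁻¹) (gaugePair (scShift' d L mv kk r hL) (S' k))) (Sum.inl μ) x)) (((scShift' d L mv kk r hL) μ).symm x') i j - fgradMat (((L ^ kk : ℕ) : ℝ)) ((scShift d L mv kk hL) μ) (fun x => (scBump d L mv kk hL k x • (tCoefA ((((L ^ kk : ℕ) : ℝ))⁻¹) (gaugePair (scShift d L mv kk hL) (S k))) (Sum.inl μ) x)) (((scShift d L mv kk hL) μ).symm ((kingPr L kk r (cvM d L mv kk hL)) x')) i j| ≤ (((((L ^ mv : ℕ) : ℝ))⁻¹ * ((((L ^ kk : ℕ) : ℝ)) * ((L ^ mv : ℕ)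 : ℝ))⁻¹ * (32 * π ^ 4 + π ^ 2 * (d + 1))) * rV + (π / ((L ^ mv : ℕ) : ℝ)) * (oV + ((((L ^ kk : ℕ) : ℝ))⁻¹) * rD) + (π * (d + 1) / ((((L ^ kk : ℕ) : ℝ)) * ((L ^ mv : ℕ) : ℝ))) * rD + Fintype.card ι * oB) := fun k μ x' i => by
    refine rowSum_fgradMat_smul_fit_le' (((L ^ r * L ^ kk : ℕ) : ℝ)) (((L ^ kk : ℕ) : ℝ)) ((scShift' d L mv kk r hL) μ) ((scShift d L mv kk hL) μ) (scBump' d L mv kk r hL k) (scBump d L mv kk hL k) ((tCoefA ((((L ^ r * L ^ kk : ℕ) : ℝ))⁻¹) (gaugePair (scShift' d L mv kk r hL) (S' k))) (Sum.inl μ)) ((tCoefA ((((L ^ kk : ℕ) : ℝ))⁻¹) (gaugePair (scShift d L mv kk hL) (S k))) (Sum.inl μ)) (((scShift' d L mv kk r hL) μ).symm x') (((scShift d L mv kk hL) μ).symm ((kingPr L kk r (cvM d L mv kk hL)) x'))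
      ho₂0 hct0 hoχ0 hrV (by positivity : (0 : ℝ) ≤ oV + ((((L ^ kk : ℕ) : ℝ))⁻¹) * rD) hrD (by positivity : (0 : ℝ) ≤ Fintype.card ι * oB)
      (by rw [Equiv.apply_symm_apply, Equiv.apply_symm_apply]; exact hfit₂b k μ x') (by rw [Equiv.apply_symm_apply]; exact hctB k μ ((kingPr L kk r (cvM d L mv kk hL)) x'))
      (by rw [Equiv.apply_symm_apply, Equiv.apply_symm_apply]; exact hfitχ k x') (hb1 k _) i (fun h => hAloc' k (Sum.inl μ) _ ?_ i) (fun h => ?_) (fun h => (hDA' k μ _ ?_ i).1) (fun h => ?_)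
    · -- a live quotient weight ⟹ `χ′(x′ − e′) ≠ 0`
      rcases h with h | h
      · rw [(hpairF k μ _ h).1]; exact one_ne_zero
      · obtain ⟨hc1, hc2⟩ := hpairC k μ _ h
        rw [Equiv.apply_symm_apply] at hc2
        exact hχ'B k μ x' hc2 hc1
    · -- the SHIFTED sharp value fit: King's dichotomy, at most one coarse step
      obtain ⟨hc1, hc2⟩ := hpairC k μ _ h
      rw [Equiv.apply_symm_apply] at hc2
      rcases hcrossB μ x' with e | e
      · refine (rowSum_sub_le_of_mid _ ((tCoefA ((((L ^ kk : ℕ) : ℝ))⁻¹) (gaugePair (scShift d L mv kk hL) (S k))) (Sum.inl μ) ((kingPr L kk r (cvM d L mv kk hL)) x')) _ i).trans (add_le_add ?_ (hstepAf k μ _ (by rw [hc1]; exact one_ne_zero) i |> fun h2 => by rw [rowSum_sub_comm]; exact h2))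
        have hf := hfitA k (Sum.inl μ) (((scShift' d L mv kk r hL) μ).symm x') i
        rw [hal, e, hc2, one_smul, one_smul] at hf; exact hf
      · have hf := hfitA k (Sum.inl μ) (((scShift' d L mv kk r hL) μ).symm x') i
        rw [hal, e, hc1, one_smul, one_smul] at hf
        exact hf.trans (le_add_of_nonneg_right (by positivity))
    · rcases h with h | h
      · rw [Equiv.apply_symm_apply] at h; rw [((hwinF k _ h).2 μ).2]; exact one_ne_zero
      · rw [Equiv.apply_symm_apply] at h
        exact hχ'B k μ x' (hwinC k _ h).1 ((hwinC k _ h).2 μ).2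
    · -- the QUOTIENT fit of `a⁺_μ` one step back = `hB`
      rw [Equiv.apply_symm_apply] at h
      have hχ : scChi d L mv kk hL k ((kingPr L kk r (cvM d L mv kk hL)) x') ≠ 0 := by rw [(hwinC k _ h).1]; exact one_ne_zero
      refine rowSum_le_card_mul_of_entry i fun j => ?_
      have hb := hB k μ x' hχ i j
      rw [Matrix.sub_apply, fgradMat_tCoefA_inl_symm_apply, fgradMat_tCoefA_inl_symm_apply]
      simpa only [inv_inv, Matrix.sub_apply, Matrix.smul_apply, smul_eq_mul, mul_assoc] using hb
  -- (6) the quotient fit of `χ̃•a⁻_μ` (n15-c∕431b §2, shifted value form; `hB` transposed through `fgradMat_tCoefA_inr_apply'`)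
  have hgAb : ∀ k μ x' i, ∑ j, |fgradMat (((L ^ r * L ^ kk : ℕ) : ℝ)) ((scShift' d L mv kk r hL) μ) (fun x => (scBump' d L mv kk r hL k x • (tCoefA ((((L ^ r * L ^ kk : ℕ) : ℝ))⁻¹) (gaugePair (scShift' d L mv kk r hL) (S' k))) (Sum.inr μ) x)) x' i j - fgradMat (((L ^ kk : ℕ) : ℝ)) ((scShift d L mv kk hL) μ) (fun x => (scBump d L mv kk hL k x • (tCoefA ((((L ^ kk : ℕ) : ℝ))⁻¹) (gaugePair (scShift d L mv kk hL) (S k))) (Sum.inr μ) x)) ((kingPr L kk r (cvM d L mv kk hL)) x') i j| ≤ (((((L ^ mv : ℕ) : ℝ))⁻¹ * ((((L ^ kk : ℕ) : ℝ)) * ((L ^ mv : ℕ) : ℝ))⁻¹ * (32 * π ^ 4 + π ^ 2 * (d + 1))) * rV + (π / ((L ^ mv : ℕ) : ℝ)) * (oV + ((((L ^ kk : ℕ) : ℝ))⁻¹) * rD) + (π * (d + 1) / ((((L ^ kk : ℕ) : ℝ)) * ((L ^ mv : ℕ) : ℝ))) * rD + Fintype.card ι * oB) := fun k μ x' i =>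 by
    refine rowSum_fgradMat_smul_fit_le (((L ^ r * L ^ kk : ℕ) : ℝ)) (((L ^ kk : ℕ) : ℝ)) ((scShift' d L mv kk r hL) μ) ((scShift d L mv kk hL) μ) (scBump' d L mv kk r hL k) (scBump d L mv kk hL k) ((tCoefA ((((L ^ r * L ^ kk : ℕ) : ℝ))⁻¹) (gaugePair (scShift' d L mv kk r hL) (S' k))) (Sum.inr μ)) ((tCoefA ((((L ^ kk : ℕ) : ℝ))⁻¹) (gaugePair (scShift d L mv kk hL) (S k))) (Sum.inr μ)) x' ((kingPr L kk r (cvM d L mv kk hL)) x')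
      ho₂0 hct0 hoχ0 hrV (by positivity : (0 : ℝ) ≤ oV + ((((L ^ kk : ℕ) : ℝ))⁻¹) * rD) hrD (by positivity : (0 : ℝ) ≤ Fintype.card ι * oB)
      (hfit₂ k μ x') (hctF k μ ((kingPr L kk r (cvM d L mv kk hL)) x')) (hfitχ k x') (hb1 k _) i (fun h => hAloc' k (Sum.inr μ) _ ?_ i) (fun h => ?_) (fun h => (hDA' k μ _ ?_ i).2) (fun h => ?_)
    · rcases h with h | h
      · rw [(hpairF k μ _ h).2]; exact one_ne_zero
      · obtain ⟨hc1, hc2⟩ := hpairC k μ _ h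
        exact hχ'F k μ x' hc1 hc2
    · obtain ⟨hc1, hc2⟩ := hpairC k μ _ h
      rcases hcrossF μ x' with e | e
      · refine (rowSum_sub_le_of_mid _ ((tCoefA ((((L ^ kk : ℕ) : ℝ))⁻¹) (gaugePair (scShift d L mv kk hL) (S k))) (Sum.inr μ) ((kingPr L kk r (cvM d L mv kk hL)) x')) _ i).trans (add_le_add ?_ (hstepAb k μ _ (by rw [hc1]; exact one_ne_zero) i |> fun h2 => by rw [rowSum_sub_comm]; exact h2))
        have hf := hfitA k (Sum.inr μ) ((scShift' d L mv kk r hL) μ x') i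
        rw [hal, e, hc1, one_smul, one_smul] at hf; exact hf
      · have hf := hfitA k (Sum.inr μ) ((scShift' d L mv kk r hL) μ x') i
        rw [hal, e, hc2, one_smul, one_smul] at hf
        exact hf.trans (le_add_of_nonneg_right (by positivity))
    · rcases h with h | h
      · rw [(hwinF k _ h).1]; exact one_ne_zero
      · rw [hal, (hwinC k _ h).1]; exact one_ne_zero
    · have hχ : scChi d L mv kk hL k ((kingPr L kk r (cvM d L mv kk hL)) x') ≠ 0 := by rw [(hwinC k _ h).1]; exact one_ne_zero
      refine rowSum_le_card_mul_of_entry i fun j => ?_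
      have hb := hB k μ x' hχ j i
      rw [Matrix.sub_apply, fgradMat_tCoefA_inr_apply', fgradMat_tCoefA_inr_apply', neg_sub_neg, abs_sub_comm]
      simpa only [inv_inv, Matrix.sub_apply, Matrix.smul_apply, smul_eq_mul, mul_assoc] using hb
  exact ⟨hCt, hAt, hAsh1, hAsh2, hgAf, hgAb⟩

end Fits

end Summit.QuantumFields.YangMills.BalabanUVNodes.N15.Gluing

end
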